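import Summits.QuantumFields.YangMills.Theorems.UnitScaleTiltProp7TiledCubeMemberH7H8Peeled
import Summits.QuantumFields.YangMills.Theorems.UnitScaleTiltProp7TiledCubeMemberH7H8PeeledIndex
import Summits.QuantumFields.YangMills.Theorems.UnitScaleTiltProp7TiledCubeMemberH7H8Currency
import HarnessLib

/-!
# Route `UnitScaleTilt`, crux K1 «MinimiserStabilityRegPr» (stmt-QuantumFields-19200) — LANE II [I-5]∕[I-9] (a′) FILE 6d — **`h7 ⊕ h8` IN BUDGET CURRENCY AT ONE PATCH**
# (the px9 E2E certificate of 2026-08-29 13:28∕13:39Z turned into a theorem, so PATCHES1's `patch_rows` takes the two budget slots by ONE call).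

Cell `ym3-torus` ∕ width seat `ym3-torus-px9` (gen 8).  THEOREMS ONLY (0 `def`, 0 `sorry`); `--supports stmt-QuantumFields-19200 --as helper`, count-neutral.
YM₃ on T³ is a ladder rung (R3), NOT d = 4, NOT infinite volume, NOT a mass gap, NOT Clay; nothing here claims (B7), (REC), `hN06`, E′, EX or the gap.

WHAT IS PROVED (ns `…Theorems.Prop7TiledCubeMemberH7H8PeeledBudget`): ★★★ `h7h8_budget_rows` — see its docstring.  HONEST SCOPE: composition by name of ✓p721170 ∕
✓p721459 ∕ ✓p723592 ∕ ✓p723593 and ✓px9 g7 `blockBox_tiled`∕`two_mul_recordRadius_add_one_le`; no estimate of print beyond those.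

References: T. Bałaban, CMP 98 (1985) 17–51 [Balaban1985Averaging] (pp.24–25); CMP 99 (1985) 389–434 [Balaban1985BackgroundPropagators] ((3.100) p.413).
-/

set_option autoImplicit false

namespace Summit.QuantumFields.YangMills.Theorems.Prop7TiledCubeMemberH7H8PeeledBudget

open scoped BigOperators Matrix.Norms.L2Operator
open Literature.MathematicalPhysics.QuantumFieldTheory.Balaban1983to89
open Literature.MathematicalPhysics.QuantumFieldTheory.Balaban1983to89.T3ContinuumYM3Torus
open Literature.MathematicalPhysics.QuantumFieldTheory.Balaban1983to89.T3PrintedRegularMinimiser (RegPr)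
open Literature.MathematicalPhysics.QuantumFieldTheory.Balaban1983to89.B4Eq19LatticeOperators (Zd box unitVec mem_box box_mono)
open Literature.MathematicalPhysics.QuantumLattice (blockMap blockBase blockSites)
open B10Eq27TorusAxialLog (transl pull pull_apply holT unitsField toUField)
open B7Prop1Explicit (axialFn U1 e)
open B7Prop2Explicit (C0 c2')
open B7Eq78Linearization (conjR QprimeIter zdBlocking)
open T4TermwiseTorus (tlift)
open T3SectALandauChart (eta eta_pos bgUnits)
open B11Eq103H1Complex (SiteL2K BondL2K)
open Summit.QuantumFields.YangMills.Theorems.Prop7SectET3Transport (periodsT3)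
open Summit.QuantumFields.YangMills.Theorems.Prop7SectET3HilbertLetters (W₂ toL2 toL2S DL2)
open Summit.QuantumFields.YangMills.Theorems.Prop7SPrint (basePt)
open Summit.QuantumFields.YangMills.Theorems.Prop7QprimeCombL2 (QprimeCombL2)
open Summit.QuantumFields.YangMills.Theorems.Prop7Lane2SupportInChart (blockBox_tiled two_mul_recordRadius_add_one_le)
open Summit.QuantumFields.YangMills.Theorems.Prop7TiledCubeMemberH7H8PeeledA (peeled_tiled)
open Summit.QuantumFields.YangMills.Theorems.Prop7TiledCubeMemberH7H8Peeled (h7h8_member_peeled)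
open Summit.QuantumFields.YangMills.Theorems.Prop7TiledCubeMemberH7H8PeeledIndex (layer_ratio_eq record_radii_real)
open Summit.QuantumFields.YangMills.Theorems.Prop7TiledCubeMemberH7H8Currency (currency_h7h8_peeled)

set_option maxHeartbeats 400000 in
-- hb: the peeled member row, four lattice side rows and the 24-binder currency lemma unify over kilobyte-long atoms (measured: fails at 200k, passes at 400k)
/-- ★★★ **(a′) `h7 ⊕ h8` IN BUDGET CURRENCY AT ONE PATCH, BY NAME** (px9 E2E certificate of 13:28∕13:39Z as a theorem): at the record chart box `box zc R_f` of a block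
vector `B′` (`zc i = ℓ·B′ i + (ℓ−1)∕2`, `R_f = (2L^s+1)ℓ + (ℓ−1)∕2`), from (B8-member)'s pass-through rows `hP hφZ h0`, (h1) `hGN : Gφ_in ≤ N`, (h2) `h2 : ‖φ‖² ≤ CΦ·L^{2s}·N`,
the px5 window `he4` and any unit coarse transporter `T` with the (B3c) rider: `∃ Φt Nt Gc`, `Φt =` the PEELED box mass (`R_in = R_f − 5ℓ`), `Gc =` the coarse
`Ū`-difference sum over the peeled image set `ι(C(B′ − (2L^s+1) + 5, 4L^s − 8))`, and ✓`patch_budget_v2`'s two slots `h7 : Φt ≤ (1106568 + 87360·CΦ)·(N + ε²‖φ‖²) + Nt`,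
`h8 : Nt ≤ 672·(L^s)²·Gc + (7648598016·A² + 4032((2CT+29568)² + 29484²))·(L^s)⁴·ε²·‖φ‖²` (`4 ≤ L^s`). Script: ✓`blockBox_tiled` ▸ ✓`peeled_tiled … 5` ▸
✓`h7h8_member_peeled` ▸ ✓`record_radii_real … 5` ▸ ✓`layer_ratio_eq` ▸ ✓`currency_h7h8_peeled`. [cite: Balaban1985Averaging, pp.24-25; Balaban1985BackgroundPropagators, (3.100) p.413] -/
theorem h7h8_budget_rows (F : T3Family) (n K s : ℕ) (c₀ : ℝ) [Fact (0 < c₀)] (hnK : n ≤ K) (hs : s < F.m + n) (hR4 : 4 ≤ F.L ^ s)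
    {L : ℕ} (hL : 1 < L) (hF : F.L = L) {ε : ℝ} (he : 0 < ε) (he4 : ε ≤ min (6 * C0 3)⁻¹ (c2' 3 L / 4))
    (W : GaugeField (F.P K) 0 (Matrix.specialUnitaryGroup (Fin 2) ℂ)) (hW : RegPr F n K ε W)
    {CT : ℝ} (hCT : 0 ≤ CT) (T : PBond (F.P K) (K - n) → (Matrix (Fin 2) (Fin 2) ℂ)ˣ) (hTU1 : ∀ c, T c ∈ U1 (Matrix (Fin 2) (Fin 2) ℂ))
    (hclose : ∀ c : PBond (F.P K) (K - n),
      ‖(T c : Matrix (Fin 2) (Fin 2) ℂ) - ((holT (unitsField (toUField W)) (transl (basePt F n K) (blockBase ((F.P K).L ^ (K - n)) (tlift c.src)))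
          (List.replicate ((F.P K).L ^ (K - n)) (c.dir, true)) : (Matrix (Fin 2) (Fin 2) ℂ)ˣ) : Matrix (Fin 2) (Fin 2) ℂ)‖ ≤ CT * ε)
    (B' : Zd (F.P K).d)
    (V : Zd (F.P K).d → Fin (F.P K).d → (Matrix (Fin 2) (Fin 2) ℂ)ˣ) (hV : ∀ w μ, V w μ = unitsField (toUField W) ⟨transl (basePt F n K) w, μ⟩)
    {α A : ℝ} (hα : 0 ≤ α) (hαe : α ≤ A * ε * eta F n K ^ 2)
    (hP : B8Lemma1NonAbelian.PlaqSmall V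
      (fun i => (((F.L ^ (K - n) : ℕ) : ℤ) * B' i + (((F.L ^ (K - n) : ℕ) : ℤ) - 1) / 2) - ((2 * ((F.L ^ s : ℕ) : ℤ) + 1) * ((F.L ^ (K - n) : ℕ) : ℤ) + (((F.L ^ (K - n) : ℕ) : ℤ) - 1) / 2))
      (fun i => (((F.L ^ (K - n) : ℕ) : ℤ) * B' i + (((F.L ^ (K - n) : ℕ) : ℤ) - 1) / 2) + ((2 * ((F.L ^ s : ℕ) : ℤ) + 1) * ((F.L ^ (K - n) : ℕ) : ℤ) + (((F.L ^ (K - n) : ℕ) : ℤ) - 1) / 2)) α)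
    (φ : SiteL2K ℂ 3 (periodsT3 F K) c₀ W₂) (φZ : Zd (F.P K).d → Matrix (Fin 2) (Fin 2) ℂ)
    (hφZ : ∀ w ∈ box (fun i : Fin (F.P K).d => ((F.L ^ (K - n) : ℕ) : ℤ) * B' i + (((F.L ^ (K - n) : ℕ) : ℤ) - 1) / 2)
        ((2 * ((F.L ^ s : ℕ) : ℤ) + 1) * ((F.L ^ (K - n) : ℕ) : ℤ) + (((F.L ^ (K - n) : ℕ) : ℤ) - 1) / 2),
      (toL2S F K c₀).symm φ (transl (basePt F n K) w) = (eta F n K) • φZ w)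
    (h0 : ∑ w ∈ box (fun i : Fin (F.P K).d => ((F.L ^ (K - n) : ℕ) : ℤ) * B' i + (((F.L ^ (K - n) : ℕ) : ℤ) - 1) / 2)
        ((2 * ((F.L ^ s : ℕ) : ℤ) + 1) * ((F.L ^ (K - n) : ℕ) : ℤ) + (((F.L ^ (K - n) : ℕ) : ℤ) - 1) / 2),
        conjR (axialFn V (fun i => (((F.L ^ (K - n) : ℕ) : ℤ) * B' i + (((F.L ^ (K - n) : ℕ) : ℤ) - 1) / 2)
          - ((2 * ((F.L ^ s : ℕ) : ℤ) + 1) * ((F.L ^ (K - n) : ℕ) : ℤ) + (((F.L ^ (K - n) : ℕ) : ℤ) - 1) / 2)) w) (φZ w) = 0)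
    {N CΦ : ℝ} (hCΦ : 0 ≤ CΦ)
    (hGN : c₀ * ∑ w ∈ box (fun i : Fin (F.P K).d => ((F.L ^ (K - n) : ℕ) : ℤ) * B' i + (((F.L ^ (K - n) : ℕ) : ℤ) - 1) / 2)
        ((2 * ((F.L ^ s : ℕ) : ℤ) + 1) * ((F.L ^ (K - n) : ℕ) : ℤ) + (((F.L ^ (K - n) : ℕ) : ℤ) - 1) / 2), ∑ μ,
        (if w + unitVec μ ∈ box (fun i : Fin (F.P K).d => ((F.L ^ (K - n) : ℕ) : ℤ) * B' i + (((F.L ^ (K - n) : ℕ) : ℤ) - 1) / 2)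
            ((2 * ((F.L ^ s : ℕ) : ℤ) + 1) * ((F.L ^ (K - n) : ℕ) : ℤ) + (((F.L ^ (K - n) : ℕ) : ℤ) - 1) / 2) then
          ∑ j : Fin 2, ∑ k : Fin 2, ‖(conjR (V w μ) (φZ (w + unitVec μ)) - φZ w) j k‖ ^ 2 else 0) ≤ N)
    (h2 : ‖φ‖ ^ 2 ≤ CΦ * ((F.L : ℝ) ^ s) ^ 2 * N) :
    ∃ Φt Nt Gc : ℝ,
      Φt = c₀ * ∑ w ∈ box (fun i : Fin (F.P K).d => ((F.L ^ (K - n) : ℕ) : ℤ) * B' i + (((F.L ^ (K - n) : ℕ) : ℤ) - 1) / 2)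
          ((2 * ((F.L ^ s : ℕ) : ℤ) + 1) * ((F.L ^ (K - n) : ℕ) : ℤ) + (((F.L ^ (K - n) : ℕ) : ℤ) - 1) / 2 - ((5 : ℕ) : ℤ) * ((F.L ^ (K - n) : ℕ) : ℤ)),
          ∑ j : Fin 2, ∑ k : Fin 2, ‖((toL2S F K c₀).symm φ (transl (basePt F n K) w)) j k‖ ^ 2 ∧
      Gc = c₀ * ((((F.L ^ (K - n)) ^ (F.P K).d : ℕ) : ℝ)) *
          ∑ ĉ ∈ (((Fintype.piFinset (fun i => Finset.Icc (B' i - (2 * ((F.L ^ s : ℕ) : ℤ) + 1) + (5 : ℕ)) (B' i - (2 * ((F.L ^ s : ℕ) : ℤ) + 1) + (5 : ℕ) + (4 * F.L ^ s + 2 - 2 * 5 : ℕ))))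
              ×ˢ (Finset.univ : Finset (Fin (F.P K).d))).filter
              (fun q => q.1 + e q.2 ∈ Fintype.piFinset (fun i => Finset.Icc (B' i - (2 * ((F.L ^ s : ℕ) : ℤ) + 1) + (5 : ℕ)) (B' i - (2 * ((F.L ^ s : ℕ) : ℤ) + 1) + (5 : ℕ) + (4 * F.L ^ s + 2 - 2 * 5 : ℕ))))).image
              (fun q => (⟨transl (0 : Site (F.P K) (K - n)) q.1, q.2⟩ : PBond (F.P K) (K - n))),
            ‖conjR (T ĉ) (QprimeCombL2 F n K c₀ W φ (ĉ.src.shift ĉ.dir)) - QprimeCombL2 F n K c₀ W φ ĉ.src‖ ^ 2 ∧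
      Φt ≤ (1106568 + 87360 * CΦ) * (N + ε ^ 2 * ‖φ‖ ^ 2) + Nt ∧
      Nt ≤ 672 * ((F.L : ℝ) ^ s) ^ 2 * Gc + (7648598016 * A ^ 2 + 4032 * ((2 * CT + 29568) ^ 2 + 29484 ^ 2)) * ((F.L : ℝ) ^ s) ^ 4 * ε ^ 2 * ‖φ‖ ^ 2 := by
  have hL0 : 0 < F.L := by have := F.hL.2; omega
  have hℓ1 : 1 ≤ F.L ^ (K - n) := Nat.one_le_pow _ _ hL0
  have hR2 : 2 ≤ F.L ^ s := le_trans (by norm_num) hR4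
  -- the chart box of record is tiled; the record radius fits and is nonnegative
  have hzlo : ∀ i, (((F.L ^ (K - n) : ℕ) : ℤ) * B' i + (((F.L ^ (K - n) : ℕ) : ℤ) - 1) / 2)
      - ((2 * ((F.L ^ s : ℕ) : ℤ) + 1) * ((F.L ^ (K - n) : ℕ) : ℤ) + (((F.L ^ (K - n) : ℕ) : ℤ) - 1) / 2)
      = ((F.L ^ (K - n) : ℕ) : ℤ) * (B' i - (2 * ((F.L ^ s : ℕ) : ℤ) + 1)) := fun i => (blockBox_tiled F n K s B' i).1
  have hzhi : ∀ i, (((F.L ^ (K - n) : ℕ) : ℤ) * B' i + (((F.L ^ (K - n) : ℕ) : ℤ) - 1) / 2)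
      + ((2 * ((F.L ^ s : ℕ) : ℤ) + 1) * ((F.L ^ (K - n) : ℕ) : ℤ) + (((F.L ^ (K - n) : ℕ) : ℤ) - 1) / 2)
      = ((F.L ^ (K - n) : ℕ) : ℤ) * (B' i - (2 * ((F.L ^ s : ℕ) : ℤ) + 1)) + (((4 * F.L ^ s + 2 + 1) * F.L ^ (K - n) - 1 : ℕ) : ℤ) :=
    fun i => (blockBox_tiled F n K s B' i).2
  have hRN := two_mul_recordRadius_add_one_le F n K s hnK hs hR2
  have hRf0 : (0 : ℤ) ≤ (2 * ((F.L ^ s : ℕ) : ℤ) + 1) * ((F.L ^ (K - n) : ℕ) : ℤ) + (((F.L ^ (K - n) : ℕ) : ℤ) - 1) / 2 := by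
    have h1 : (1 : ℤ) ≤ ((F.L ^ (K - n) : ℕ) : ℤ) := by exact_mod_cast hℓ1
    have h2 : (0 : ℤ) ≤ ((F.L ^ s : ℕ) : ℤ) := by positivity
    have h3 : (0 : ℤ) ≤ (((F.L ^ (K - n) : ℕ) : ℤ) - 1) / 2 := Int.ediv_nonneg (by omega) (by norm_num)
    nlinarith
  -- peel four blocks
  obtain ⟨hzlo', hzhi', hRin⟩ := peeled_tiled F n K (fun i => B' i - (2 * ((F.L ^ s : ℕ) : ℤ) + 1)) (4 * F.L ^ s + 2) 5 (by omega) hzlo hzhi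
  -- the peeled member row
  have hmain := h7h8_member_peeled F n K c₀ hL hF hnK he he4 W hW T hTU1 hclose hRf0 hRN 5 hRin
    (fun i => B' i - (2 * ((F.L ^ s : ℕ) : ℤ) + 1) + (5 : ℕ)) (4 * F.L ^ s + 2 - 2 * 5) hzlo' hzhi' V hV hα hP φ φZ hφZ h0
  -- currency side conditions
  have hd : (F.P K).d = 3 := T3Family.P_d F K
  have hℓη : eta F n K * (F.L : ℝ) ^ (K - n) = 1 := by
    have hLR : (0 : ℝ) < F.L := by exact_mod_cast hL0
    show ((F.L : ℝ)⁻¹) ^ (K - n) * (F.L : ℝ) ^ (K - n) = 1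
    rw [← mul_pow, inv_mul_cancel₀ hLR.ne', one_pow]
  have hℓpos : (0 : ℝ) < (F.L : ℝ) ^ (K - n) := by positivity
  have hR₀4 : (4 : ℝ) ≤ (F.L : ℝ) ^ s := by exact_mod_cast hR4
  obtain ⟨hRf1, hRin1'⟩ := record_radii_real F n K s 5
  have hRin1 : 2 * (((2 * ((F.L ^ s : ℕ) : ℤ) + 1) * ((F.L ^ (K - n) : ℕ) : ℤ) + (((F.L ^ (K - n) : ℕ) : ℤ) - 1) / 2
      - ((5 : ℕ) : ℤ) * ((F.L ^ (K - n) : ℕ) : ℤ) : ℤ) : ℝ) + 1 = (4 * (F.L : ℝ) ^ s - 7) * (F.L : ℝ) ^ (K - n) := by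
    rw [hRin1']; push_cast; ring
  have hRf0r : (0 : ℝ) ≤ ((((2 * ((F.L ^ s : ℕ) : ℤ) + 1) * ((F.L ^ (K - n) : ℕ) : ℤ) + (((F.L ^ (K - n) : ℕ) : ℤ) - 1) / 2 : ℤ) : ℝ)) := by
    exact_mod_cast hRf0
  have hRfr : ((((2 * ((F.L ^ s : ℕ) : ℤ) + 1) * ((F.L ^ (K - n) : ℕ) : ℤ) + (((F.L ^ (K - n) : ℕ) : ℤ) - 1) / 2 : ℤ) : ℝ))
      ≤ 4 * (F.L : ℝ) ^ s * (F.L : ℝ) ^ (K - n) := by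
    have h1 : (1 : ℝ) ≤ (F.L : ℝ) ^ s := by linarith
    nlinarith [hRf1, hℓpos]
  have ht : (((5 * F.L ^ (K - n) : ℕ) : ℕ) : ℝ) = 5 * (F.L : ℝ) ^ (K - n) := by push_cast; ring
  have hLay := layer_ratio_eq F K (fun i : Fin (F.P K).d => ((F.L ^ (K - n) : ℕ) : ℤ) * B' i + (((F.L ^ (K - n) : ℕ) : ℤ) - 1) / 2)
    (Rf := (2 * ((F.L ^ s : ℕ) : ℤ) + 1) * ((F.L ^ (K - n) : ℕ) : ℤ) + (((F.L ^ (K - n) : ℕ) : ℤ) - 1) / 2)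
    (Rin := (2 * ((F.L ^ s : ℕ) : ℤ) + 1) * ((F.L ^ (K - n) : ℕ) : ℤ) + (((F.L ^ (K - n) : ℕ) : ℤ) - 1) / 2 - ((5 : ℕ) : ℤ) * ((F.L ^ (K - n) : ℕ) : ℤ))
    (by
      have h1 : (1 : ℤ) ≤ ((F.L ^ (K - n) : ℕ) : ℤ) := by exact_mod_cast hℓ1
      have h2 : (4 : ℤ) ≤ ((F.L ^ s : ℕ) : ℤ) := by exact_mod_cast hR4
      have h3 : (0 : ℤ) ≤ (((F.L ^ (K - n) : ℕ) : ℤ) - 1) / 2 := Int.ediv_nonneg (by omega) (by norm_num)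
      have h4 : ((5 : ℕ) : ℤ) = 5 := by norm_num
      rw [h4]; nlinarith)
    (by have h1 : (0 : ℤ) ≤ ((F.L ^ (K - n) : ℕ) : ℤ) := by positivity
        have h4 : ((5 : ℕ) : ℤ) = 5 := by norm_num
        rw [h4]; nlinarith)
  have hmr0 : (0 : ℝ) ≤ ((4 * F.L ^ s + 2 - 2 * 5 : ℕ) : ℝ) := Nat.cast_nonneg _
  have hmr : ((4 * F.L ^ s + 2 - 2 * 5 : ℕ) : ℝ) ≤ 4 * (F.L : ℝ) ^ s + 2 := by
    have h8 : 2 * 5 ≤ 4 * F.L ^ s + 2 := by omega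
    rw [Nat.cast_sub h8]; push_cast; linarith
  have hMr0 : (0 : ℝ) ≤ ((4 * F.L ^ s + 2 - 2 * 5 + 1 + 5 : ℕ) : ℝ) := Nat.cast_nonneg _
  have hMr : ((4 * F.L ^ s + 2 - 2 * 5 + 1 + 5 : ℕ) : ℝ) ≤ 4 * (F.L : ℝ) ^ s + 3 := by
    have h8 : 2 * 5 ≤ 4 * F.L ^ s + 2 := by omega
    rw [Nat.cast_add, Nat.cast_add, Nat.cast_sub h8]; push_cast; linarith
  have hc : 0 < c₀ := Fact.out
  have hGφ0 : 0 ≤ c₀ * ∑ w ∈ box (fun i : Fin (F.P K).d => ((F.L ^ (K - n) : ℕ) : ℤ) * B' i + (((F.L ^ (K - n) : ℕ) : ℤ) - 1) / 2)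
        ((2 * ((F.L ^ s : ℕ) : ℤ) + 1) * ((F.L ^ (K - n) : ℕ) : ℤ) + (((F.L ^ (K - n) : ℕ) : ℤ) - 1) / 2), ∑ μ,
        (if w + unitVec μ ∈ box (fun i : Fin (F.P K).d => ((F.L ^ (K - n) : ℕ) : ℤ) * B' i + (((F.L ^ (K - n) : ℕ) : ℤ) - 1) / 2)
            ((2 * ((F.L ^ s : ℕ) : ℤ) + 1) * ((F.L ^ (K - n) : ℕ) : ℤ) + (((F.L ^ (K - n) : ℕ) : ℤ) - 1) / 2) then
          ∑ j : Fin 2, ∑ k : Fin 2, ‖(conjR (V w μ) (φZ (w + unitVec μ)) - φZ w) j k‖ ^ 2 else 0) :=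
    mul_nonneg hc.le (Finset.sum_nonneg fun w _ => Finset.sum_nonneg fun μ _ => by split_ifs <;> positivity)
  refine ⟨_, _, _, rfl, rfl, currency_h7h8_peeled hd hℓη hℓpos hRf0r hRfr hR₀4 hα hαe hCT (sq_nonneg _) (by positivity) hGφ0 hCΦ hGN h2
    hmr0 hmr hMr0 hMr hRf1 hRin1 ht hLay hmain⟩


end Summit.QuantumFields.YangMills.Theorems.Prop7TiledCubeMemberH7H8PeeledBudget
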